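import Mathlib
import Summits.Ventures.HodgeRepro2.T5InducedLatticeUnits
import Summits.Ventures.HodgeRepro2.T5TateComparison
import Summits.Ventures.HodgeRepro2.T5TameRamifiedNormGroup

/-!
# The norm group at a RAMIFIED place, uniformly in the residue characteristic: the transfer to the
# integer units

`Kv ⊆ Lw` Mathlib's completions with `[Lw : Kv] = 2`, `ϖ` irreducible in `O_Kv` but NOT in `O_Lw`
(the place is RAMIFIED; `2` need NOT be a unit), `π` irreducible in `O_Lw`, `σ ≠ 1`:

* `val_algebraMap_eq_sq`: `v (alg x) = v x ^ 2` (ramification index `2`), so a `σ`-fixed element of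
  `Lw` never has valuation `exp (−1)` (`not_fixed_of_val_eq_exp_neg_one`);
* `exists_anti_integral`: a non-zero INTEGRAL anti-invariant `θ` exists (the `θ` of the induced
  lattice, `T5InducedLattice`);
* `exists_uniformizer_mem_normGroup`: `N π = π σ π` is a uniformiser `ρ` of `Kv` in the norm group —
  hence `normGroup ⊔ O_Kvˣ = ⊤` and `[Kvˣ : normGroup] = [O_Kvˣ : normGroup ∩ O_Kvˣ]`
  (`index_normGroup_eq_relIndex`);
* `map_normGroup_inf_eq`, `map_adicIntegerUnits_eq`: under `alg : Kvˣ ↪ Lwˣ`,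
  `normGroup ∩ O_Kvˣ ↦ N (O_Lwˣ)` and `O_Kvˣ ↦ (O_Lwˣ)^σ`, so
  `[Kvˣ : normGroup] = [U^σ : N U]` on the integer units `U = O_Lwˣ` (`index_normGroup_eq_relIndex_map`)
  — the `h⁰` of `T5TateComparison` (shown equal to `h⁻¹` in `T5InducedLatticeCohomology`, which this
  file does not import: the transfer needs only `T5InducedLatticeUnits` and `T5TateComparison`).

The index itself (`= 2`) is `T5QuadraticNormIndex`.

Declaration per README §8(d): «uses an L-value-free non-vanishing device: NO».
-/

namespace Summit.Ventures.HodgeRepro2.T5RamifiedNormTransfer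

open IsDedekindDomain HeightOneSpectrum WithZero T5InducedLattice T5InducedLatticeUnits
  T5TateComparison T5AdicCompletionNormGroup

variable {K : Type*} [Field K] [NumberField K] (v : HeightOneSpectrum (NumberField.RingOfIntegers K))
  {L : Type*} [Field L] [NumberField L] [Algebra K L]
  (w : HeightOneSpectrum (NumberField.RingOfIntegers L)) [w.asIdeal.LiesOver v.asIdeal]
  (σ : Gal(adicCompletion L w/adicCompletion K v))
  (h2 : Module.finrank (adicCompletion K v) (adicCompletion L w) = 2)
  {ϖ : adicCompletionIntegers K v} (hϖ : Irreducible ϖ)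
  {π : adicCompletionIntegers L w} (hπ : Irreducible π)
  (hram : ¬ Irreducible (algebraMap (adicCompletionIntegers K v) (adicCompletionIntegers L w) ϖ))
  (hσ : σ ≠ 1)

section Valuations

include h2 hϖ hπ hram in
/-- At a ramified place `v (alg x) = v x ^ 2` for every `x ∈ Kv`. -/
theorem val_algebraMap_eq_sq (x : adicCompletion K v) :
    Valued.v (algebraMap (adicCompletion K v) (adicCompletion L w) x) = Valued.v x ^ 2 := by
  obtain ⟨e, he, hval⟩ := T5AdicCompletionIntegral.exists_val_algebraMap_eq_pow v w
  have he2 : e = 2 := by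
    have h1 := hval (ϖ : adicCompletion K v)
    rw [T5TameRamifiedNormGroup.val_algebraMap_uniformizer v w h2 hϖ hπ hram,
      (T5AdicCompletionConductor.irreducible_iff_val_eq_exp_neg_one v ϖ).mp hϖ, ← exp_nsmul,
      exp_inj] at h1
    simp only [smul_neg, nsmul_eq_mul] at h1
    omega
  rw [hval, he2]

include h2 hϖ hπ hram hσ in
/-- A `σ`-fixed element of `Lw` never has valuation `exp (−1)` (its exponent is even). -/
theorem not_fixed_of_val_eq_exp_neg_one {x : adicCompletion L w} (hx : Valued.v x = exp (-1))
    (hfix : σ x = x) : False := by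
  haveI : FiniteDimensional (adicCompletion K v) (adicCompletion L w) :=
    FiniteDimensional.of_finrank_eq_succ h2
  obtain ⟨y, hy⟩ := T5QuadraticAutomorphism.mem_range_of_fixed h2 σ hσ hfix
  rw [← hy, val_algebraMap_eq_sq v w h2 hϖ hπ hram] at hx
  have hy0 : Valued.v y ≠ 0 := by
    intro h0; rw [h0, zero_pow two_ne_zero] at hx; exact exp_ne_zero hx.symm
  obtain ⟨k, hk⟩ : ∃ k : ℤ, Valued.v y = exp k := ⟨_, (exp_log hy0).symm⟩
  rw [hk, ← exp_nsmul, exp_inj] at hx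
  simp only [nsmul_eq_mul, Nat.cast_ofNat] at hx
  omega

/-- `v π = exp (−1)`. -/
theorem val_pi (hπ : Irreducible π) : Valued.v (π : adicCompletion L w) = exp (-1) :=
  (T5AdicCompletionConductor.irreducible_iff_val_eq_exp_neg_one w π).mp hπ

/-- Membership in the integer units is `v = 1`. -/
theorem mem_adicIntegerUnits_iff_val_eq_one {M : Type*} [Field M] [NumberField M]
    (u : HeightOneSpectrum (NumberField.RingOfIntegers M)) (x : (adicCompletion M u)ˣ) :
    x ∈ T5AdicCompletionEmbedding.adicIntegerUnits u ↔ Valued.v (x : adicCompletion M u) = 1 := by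
  rw [T5AdicCompletionEmbedding.mem_adicIntegerUnits_iff, mem_adicCompletionIntegers,
    mem_adicCompletionIntegers, Units.val_inv_eq_inv_val, map_inv₀]
  constructor
  · rintro ⟨h1, h2⟩
    have hne : Valued.v (x : adicCompletion M u) ≠ 0 := (Valuation.ne_zero_iff _).mpr x.ne_zero
    have := inv_le_one₀ (lt_of_le_of_ne zero_le hne.symm) |>.mp h2
    exact le_antisymm h1 this
  · intro h
    rw [h, inv_one]
    exact ⟨le_rfl, le_rfl⟩

end Valuations

section Theta

include h2 hϖ hπ hram hσ in
/-- A non-zero INTEGRAL anti-invariant element exists (rescale `T5QuadraticBasis.exists_anti_ne_zero`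
by powers of `alg ϖ`). -/
theorem exists_anti_integral :
    ∃ θ : adicCompletion L w, σ θ = -θ ∧ θ ≠ 0 ∧ Valued.v θ ≤ 1 := by
  haveI : FiniteDimensional (adicCompletion K v) (adicCompletion L w) :=
    FiniteDimensional.of_finrank_eq_succ h2
  obtain ⟨δ, hδ, hδ0⟩ := T5QuadraticBasis.exists_anti_ne_zero h2 σ hσ
  set P := algebraMap (adicCompletion K v) (adicCompletion L w) (ϖ : adicCompletion K v) with hP
  have hPv : Valued.v P = exp (-2) := T5TameRamifiedNormGroup.val_algebraMap_uniformizer v w h2 hϖ hπ hram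
  have hP0 : P ≠ 0 := by
    intro h; rw [h, map_zero] at hPv; exact exp_ne_zero hPv.symm
  have hσP : σ P = P := σ.commutes _
  have hδv : Valued.v δ ≠ 0 := (Valuation.ne_zero_iff _).mpr hδ0
  obtain ⟨k, hk⟩ : ∃ k : ℤ, Valued.v δ = exp k := ⟨_, (exp_log hδv).symm⟩
  set m : ℕ := k.toNat with hm
  refine ⟨δ * P ^ m, ?_, mul_ne_zero hδ0 (pow_ne_zero _ hP0), ?_⟩
  · rw [map_mul, map_pow, hδ, hσP, neg_mul]
  · rw [map_mul, map_pow, hk, hPv, ← exp_nsmul, ← exp_add, ← exp_zero, exp_le_exp]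
    have : (k : ℤ) ≤ m := Int.self_le_toNat k
    simp only [smul_neg, nsmul_eq_mul]
    omega

end Theta

section Uniformizer

include h2 hϖ hπ hram hσ in
/-- `N π = π σ π` is a uniformiser of `Kv` lying in the norm group. -/
theorem exists_uniformizer_mem_normGroup :
    ∃ ρ : (adicCompletion K v)ˣ, Valued.v (ρ : adicCompletion K v) = exp (-1) ∧ ρ ∈ normGroup v w σ := by
  haveI : FiniteDimensional (adicCompletion K v) (adicCompletion L w) :=
    FiniteDimensional.of_finrank_eq_succ h2
  set p : adicCompletion L w := (π : adicCompletion L w) with hp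
  have hfix : σ (p * σ p) = p * σ p := by
    rw [map_mul, T5QuadraticAutomorphism.apply_apply h2 σ hσ, mul_comm]
  have hpv : Valued.v p = exp (-1) := val_pi w hπ
  have hNv : Valued.v (p * σ p) = exp (-2) := by
    rw [map_mul, T5AdicCompletionGaloisInvariance.val_algEquiv_apply v w σ, hpv, ← exp_add]
    norm_num
  have hle : Valued.v (p * σ p) ≤ 1 := by
    rw [hNv, ← exp_zero, exp_le_exp]; norm_num
  obtain ⟨r, hr⟩ := T5TameRamifiedNormGroup.exists_algebraMap_eq_of_fixed v w σ h2 hσ hle hfix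
  have hrv : Valued.v (r : adicCompletion K v) = exp (-1) := by
    have h1 := hNv
    rw [hr, val_algebraMap_eq_sq v w h2 hϖ hπ hram] at h1
    have hr0 : Valued.v (r : adicCompletion K v) ≠ 0 := by
      intro h0; rw [h0, zero_pow two_ne_zero] at h1; exact exp_ne_zero h1.symm
    obtain ⟨l, hl⟩ : ∃ l : ℤ, Valued.v (r : adicCompletion K v) = exp l := ⟨_, (exp_log hr0).symm⟩
    rw [hl, ← exp_nsmul, exp_inj] at h1
    rw [hl]
    congr 1
    simp only [nsmul_eq_mul, Nat.cast_ofNat] at h1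
    omega
  have hr0 : (r : adicCompletion K v) ≠ 0 := by
    intro h0; rw [h0, map_zero] at hrv; exact exp_ne_zero hrv.symm
  refine ⟨Units.mk0 _ hr0, hrv, p, ?_⟩
  rw [Units.val_mk0, ← hr]

include h2 hϖ hπ hram hσ in
/-- `normGroup ⊔ O_Kvˣ = ⊤`: every `y ∈ Kvˣ` is `u · ρ^m` with `u` a unit and `ρ ∈ normGroup`. -/
theorem normGroup_sup_adicIntegerUnits_eq_top :
    normGroup v w σ ⊔ T5AdicCompletionEmbedding.adicIntegerUnits v = ⊤ := by
  obtain ⟨ρ, hρv, hρN⟩ := exists_uniformizer_mem_normGroup v w σ h2 hϖ hπ hram hσ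
  rw [eq_top_iff]
  intro b _
  obtain ⟨u, hu1, hu⟩ := T5UnramifiedCharacter.exists_val_eq_one_mul_zpow hρv b.ne_zero
  have hu0 : u ≠ 0 := by
    intro h0; rw [h0, map_zero] at hu1; exact zero_ne_one hu1
  have hbK : b = ρ ^ (-(Valued.v (b : adicCompletion K v)).log) * Units.mk0 u hu0 := by
    apply Units.ext
    rw [Units.val_mul, Units.val_zpow_eq_zpow_val, Units.val_mk0, mul_comm]
    exact hu
  rw [hbK]
  exact Subgroup.mul_mem_sup (Subgroup.zpow_mem _ hρN _)
    ((mem_adicIntegerUnits_iff_val_eq_one v _).mpr (by rw [Units.val_mk0]; exact hu1))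

include h2 hϖ hπ hram hσ in
/-- `[Kvˣ : normGroup] = [O_Kvˣ : normGroup ∩ O_Kvˣ]`. -/
theorem index_normGroup_eq_relIndex :
    (normGroup v w σ).index = (normGroup v w σ).relIndex (T5AdicCompletionEmbedding.adicIntegerUnits v) := by
  rw [← Subgroup.relIndex_top_right, ← normGroup_sup_adicIntegerUnits_eq_top v w σ h2 hϖ hπ hram hσ,
    sup_comm, Subgroup.relIndex_sup_right]

end Uniformizer

section Transfer

/-- The embedding `Kvˣ → Lwˣ`. -/
noncomputable def unitsAlg : (adicCompletion K v)ˣ →* (adicCompletion L w)ˣ :=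
  Units.map (algebraMap (adicCompletion K v) (adicCompletion L w) : adicCompletion K v →* adicCompletion L w)

/-- `unitsAlg` on an element. -/
@[simp] theorem coe_unitsAlg (y : (adicCompletion K v)ˣ) :
    ((unitsAlg v w y : (adicCompletion L w)ˣ) : adicCompletion L w) =
      algebraMap (adicCompletion K v) (adicCompletion L w) (y : adicCompletion K v) := rfl

/-- `unitsAlg` is injective. -/
theorem unitsAlg_injective : Function.Injective (unitsAlg v w) :=
  Units.map_injective (algebraMap (adicCompletion K v) (adicCompletion L w)).injective

include h2 hϖ hπ hram hσ in
/-- `(normGroup ∩ O_Kvˣ).map alg = U.map N` (`U = O_Lwˣ`, `N = normHom (unitsAut σ)`). -/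
theorem map_normGroup_inf_eq :
    (normGroup v w σ ⊓ T5AdicCompletionEmbedding.adicIntegerUnits v).map (unitsAlg v w) =
      (T5AdicCompletionEmbedding.adicIntegerUnits w).map (normHom (unitsAut v w σ)) := by
  haveI : FiniteDimensional (adicCompletion K v) (adicCompletion L w) :=
    FiniteDimensional.of_finrank_eq_succ h2
  ext b
  simp only [Subgroup.mem_map, Subgroup.mem_inf]
  constructor
  · rintro ⟨y, ⟨⟨x, hx⟩, hyU⟩, rfl⟩
    rw [mem_adicIntegerUnits_iff_val_eq_one] at hyU
    have hxv : Valued.v x = 1 := by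
      have h := congrArg Valued.v hx
      rw [val_mul_algEquiv v w σ, val_algebraMap_eq_sq v w h2 hϖ hπ hram, hyU, one_pow] at h
      exact pow_eq_one_iff_of_nonneg zero_le two_ne_zero |>.mp h
    have hx0 : x ≠ 0 := by
      intro h0; rw [h0, map_zero] at hxv; exact zero_ne_one hxv
    refine ⟨Units.mk0 x hx0, (mem_adicIntegerUnits_iff_val_eq_one w _).mpr (by rw [Units.val_mk0]; exact hxv), ?_⟩
    apply Units.ext
    rw [T5TateComparison.normHom_apply, Units.val_mul, coe_unitsAut, Units.val_mk0, coe_unitsAlg]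
    exact hx
  · rintro ⟨u, huU, rfl⟩
    rw [mem_adicIntegerUnits_iff_val_eq_one] at huU
    have hfix : σ ((u : adicCompletion L w) * σ u) = (u : adicCompletion L w) * σ u := by
      rw [map_mul, T5QuadraticAutomorphism.apply_apply h2 σ hσ, mul_comm]
    obtain ⟨y, hy⟩ := T5QuadraticAutomorphism.mem_range_of_fixed h2 σ hσ hfix
    have hyv : Valued.v y = 1 := by
      have h := congrArg Valued.v hy
      rw [val_algebraMap_eq_sq v w h2 hϖ hπ hram, val_mul_algEquiv v w σ, huU, one_pow] at h
      exact pow_eq_one_iff_of_nonneg zero_le two_ne_zero |>.mp h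
    have hy0 : y ≠ 0 := by
      intro h0; rw [h0, map_zero] at hyv; exact zero_ne_one hyv
    refine ⟨Units.mk0 y hy0, ⟨⟨u, by rw [Units.val_mk0]; exact hy.symm⟩,
      (mem_adicIntegerUnits_iff_val_eq_one v _).mpr (by rw [Units.val_mk0]; exact hyv)⟩, ?_⟩
    apply Units.ext
    rw [coe_unitsAlg, Units.val_mk0, T5TateComparison.normHom_apply, Units.val_mul, coe_unitsAut]
    exact hy

include h2 hϖ hπ hram hσ in
/-- `O_Kvˣ.map alg = ker D ∩ U`: the `σ`-fixed integer units of `Lw` are the integer units of `Kv`. -/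
theorem map_adicIntegerUnits_eq :
    (T5AdicCompletionEmbedding.adicIntegerUnits v).map (unitsAlg v w) =
      (diffHom (unitsAut v w σ)).ker ⊓ T5AdicCompletionEmbedding.adicIntegerUnits w := by
  haveI : FiniteDimensional (adicCompletion K v) (adicCompletion L w) :=
    FiniteDimensional.of_finrank_eq_succ h2
  ext b
  simp only [Subgroup.mem_map, Subgroup.mem_inf]
  constructor
  · rintro ⟨y, hyU, rfl⟩
    rw [mem_adicIntegerUnits_iff_val_eq_one] at hyU
    refine ⟨?_, ?_⟩
    · rw [mem_ker_diffHom]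
      apply Units.ext
      rw [coe_unitsAut, coe_unitsAlg]
      exact σ.commutes _
    · rw [mem_adicIntegerUnits_iff_val_eq_one, coe_unitsAlg, val_algebraMap_eq_sq v w h2 hϖ hπ hram, hyU,
        one_pow]
  · rintro ⟨hfix, hbU⟩
    rw [mem_ker_diffHom] at hfix
    rw [mem_adicIntegerUnits_iff_val_eq_one] at hbU
    have hfix' : σ (b : adicCompletion L w) = b := congrArg Units.val hfix
    obtain ⟨y, hy⟩ := T5QuadraticAutomorphism.mem_range_of_fixed h2 σ hσ hfix'
    have hyv : Valued.v y = 1 := by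
      have h := congrArg Valued.v hy
      rw [val_algebraMap_eq_sq v w h2 hϖ hπ hram, hbU] at h
      exact pow_eq_one_iff_of_nonneg zero_le two_ne_zero |>.mp h
    have hy0 : y ≠ 0 := by
      intro h0; rw [h0, map_zero] at hyv; exact zero_ne_one hyv
    refine ⟨Units.mk0 y hy0, (mem_adicIntegerUnits_iff_val_eq_one v _).mpr (by rw [Units.val_mk0]; exact hyv), ?_⟩
    apply Units.ext
    rw [coe_unitsAlg, Units.val_mk0]
    exact hy

include h2 hϖ hπ hram hσ in
/-- `[Kvˣ : normGroup] = [U^σ : N U]` on the integer units `U = O_Lwˣ`. -/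
theorem index_normGroup_eq_relIndex_map :
    (normGroup v w σ).index =
      ((T5AdicCompletionEmbedding.adicIntegerUnits w).map (normHom (unitsAut v w σ))).relIndex
        ((diffHom (unitsAut v w σ)).ker ⊓ T5AdicCompletionEmbedding.adicIntegerUnits w) := by
  rw [index_normGroup_eq_relIndex v w σ h2 hϖ hπ hram hσ, ← Subgroup.inf_relIndex_right,
    ← map_normGroup_inf_eq v w σ h2 hϖ hπ hram hσ, ← map_adicIntegerUnits_eq v w σ h2 hϖ hπ hram hσ,
    Subgroup.relIndex_map_map_of_injective _ _ (unitsAlg_injective v w)]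

end Transfer

end Summit.Ventures.HodgeRepro2.T5RamifiedNormTransfer
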